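import Summits.ResolutionOfSingularities.ResolutionOfSingularities.Theorems.HilbertSamuelEliminationSigmaMaxModificationsCorridor3WLadderStrataClean
import HarnessLib

/-!
# [OURS · L1 W4.2] ROW (K-ctr), CURVE-CENTRE CASE, part A (topology): over a blown-up regular CURVE `D ∋ x_n` the members of
# `X_{n+1}(ν)` through `x_{n+1}` mapping into `D` DOMINATE `D` and are UNIQUE (crux chain w42, STUB TABLE «(K-ctr) 038@e=2 +
# curve-centre dominant via Thm 3.6 / 3.14-at-η», hand res-D-pv-038)

OURS (cell `res-hironaka`, slot W4.2, crux `stmt-ResolutionOfSingularities-18506` / conjunct `-19249`; `--supports … --as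
helper`, counted 0).  NOT a statement of the manuscript under review [claim: Hironaka2017, status: under-review] nor of
[CossartJannsenSaito2020]; AI plumbing, weaker than expert review; every `theorem` is PROVED, no definition is introduced.

## What (clause 1 of stub-4's row `Moving.StrataCentreMembersClean`, p516588, at a CURVE-centre step — pure topology)

`π : X′ ⟶ X` (any morphism; generic points of dominant members are read through closures), `D ⊆ X` closed and a CURVE at the closed point `x = π(x′)` in stub-4's sense
(every irreducible closed subset of `D` through `x` is `{x}` or `D`), `η` its generic point, `W ⊆ X′` closed (the `ν`-stratum of the
stage) containing the marked point `x′`.  Two FIBRE FACTS enter as hypotheses BY NAME (they are CJS Thm. 3.14 in relative form):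
* `hfibx : (W ∩ π⁻¹{x}).Subsingleton` — at most one point of `W` over the CLOSED point `x ∈ D` (near points over `x` lie on
  `ℙ(Dir_x(X)/T_x(D)) = ℙ⁰` as `e_x(X) − dim_x D ≤ 1`; res-type-001's T7b general-centre clause — the same binder as RECOGNITION (R4));
* `hfibη : (W ∩ π⁻¹{η}).Subsingleton` — at most one point of `W` over the GENERIC point `η` of `D` (`e_η(X) ≤ e_x(X) − dim 𝒪_{D,x} ≤ 1`
  by CJS Thm. 3.6, F-65 `CossartJannsenSaito2020_thm_3_6`, then Thm. 3.14 / `ProjDir_line` at `η` after localisation — res-L1-s42-pv-1's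
  P-b door F-C, «tower corollary at generic points»).
Then:
* `not_subset_fibre_of_fibre_subsingleton` — a member `Z′ ∋ x′` of `W` other than `{x′}` is not inside the fibre over `x`;
* `closure_image_eq_of_curveAt` — hence (`D` a curve at `x`) it DOMINATES `D`: `closure (π(Z′)) = D`;
* `dominant_unique_of_fibre_subsingleton` — two irreducible components of `W` dominating `D` coincide (their generic points both lie
  over `η`);
* `strataCentreMembersClean_curveCase_unique` — clause 1 of (K-ctr) at a curve-centre step for `componentsThrough N ν s`
  (the member `{x′}`, if it is a component, is then the only component through `x′`).
Clause 2 (the dominant member is a regular curve at `x′`: DVR domination) is part B.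

[cite: CossartJannsenSaito2020, Thm. 3.14, Thm. 3.6, Rem. 6.29 (1), p. 104]
-/

noncomputable section

set_option linter.dupNamespace false -- mandated namespace `…ResolutionOfSingularities.ResolutionOfSingularities…` of this single-conjunct summit

open CategoryTheory AlgebraicGeometry TopologicalSpace Topology
open Summit.ResolutionOfSingularities.ResolutionOfSingularities.Theorems.CampaignW42
open Literature.AlgebraicGeometry.Resolution
open Summit.ResolutionOfSingularities.ResolutionOfSingularities.Theorems.SigmaMaxModificationsCorridor3

universe u

namespace Summit.ResolutionOfSingularities.ResolutionOfSingularities.Theorems.SigmaMaxModificationsCorridor3.Moving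

variable {N : ℕ} {ν : ℕ → ℕ}

/-! ## §1. Not in the fibre, hence dominant -/

/-- **At most one point of `W` over `x` ⇒ a member `Z′ ∋ x′` of `W` other than `{x′}` is not inside the fibre over `x`.**
[cite: CossartJannsenSaito2020, Thm. 3.14] -/
theorem not_subset_fibre_of_fibre_subsingleton {X X' : Scheme.{u}} (π : X' ⟶ X) {x : X} {W Z' : Set X'} (hZ'W : Z' ⊆ W)
    (hfibx : (W ∩ π.base ⁻¹' {x}).Subsingleton) {x' : X'} (hx'Z : x' ∈ Z') (hne : Z' ≠ {x'}) :
    ¬ Z' ⊆ π.base ⁻¹' {x} := by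
  intro h
  exact hne (Set.eq_singleton_iff_unique_mem.2
    ⟨hx'Z, fun z hz => hfibx ⟨hZ'W hz, h hz⟩ ⟨hZ'W hx'Z, h hx'Z⟩⟩)

/-- **A curve at `x` is dominated by every irreducible set through a point over `x` that maps into it but not into the fibre**:
`closure (π(Z′)) = D` («curve at `x`»: the irreducible closed subsets of `D` through `x` are `{x}` and `D`).
[cite: CossartJannsenSaito2020, Rem. 6.29 (1), p. 104] -/
theorem closure_image_eq_of_curveAt {X X' : Scheme.{u}} (π : X' ⟶ X) {D : Set X} (hDc : IsClosed D) {x : X}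
    (hcurve : ∀ A : Set X, IsIrreducible A → IsClosed A → x ∈ A → A ⊆ D → A = {x} ∨ A = D)
    {Z' : Set X'} (hZ'irr : IsIrreducible Z') {x' : X'} (hx'Z : x' ∈ Z') (hπx' : π.base x' = x)
    (hZ'D : π.base '' Z' ⊆ D) (hnot : ¬ Z' ⊆ π.base ⁻¹' {x}) : closure (π.base '' Z') = D := by
  have hirr : IsIrreducible (closure (π.base '' Z')) := (hZ'irr.image _ π.continuous.continuousOn).closure
  have hx : x ∈ closure (π.base '' Z') := subset_closure ⟨x', hx'Z, hπx'⟩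
  rcases hcurve _ hirr isClosed_closure hx (closure_minimal hZ'D hDc) with h | h
  · exact absurd (fun z hz => by
      have hz' : π.base z ∈ closure (π.base '' Z') := subset_closure ⟨z, hz, rfl⟩
      rw [h] at hz'
      exact hz') hnot
  · exact h

/-! ## §2. Uniqueness of the dominant member -/

/-- **At most one point of `W` over the generic point `η` of `D` ⇒ at most one irreducible component of the closed set `W` dominates
`D`** (the generic point of a dominant component maps to the generic point of the closure of its image, i.e. to `η`). [cite: CossartJannsenSaito2020, Thm. 3.14, Thm. 3.6] -/
theorem dominant_unique_of_fibre_subsingleton {X X' : Scheme.{u}} (π : X' ⟶ X) {D : Set X} {η : X}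
    (hη : IsGenericPoint η D) {W : Set X'} (hWc : IsClosed W) (hfibη : (W ∩ π.base ⁻¹' {η}).Subsingleton)
    {Z' Z'' : Set X'} (hZ' : Z' ∈ componentsIn W) (hZ'' : Z'' ∈ componentsIn W)
    (hd' : closure (π.base '' Z') = D) (hd'' : closure (π.base '' Z'') = D) : Z' = Z'' := by
  obtain ⟨ζ', hζ'⟩ := QuasiSober.sober (componentsIn.isIrreducible hZ') (componentsIn.isClosed hWc hZ')
  obtain ⟨ζ'', hζ''⟩ := QuasiSober.sober (componentsIn.isIrreducible hZ'') (componentsIn.isClosed hWc hZ'')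
  have h1 : IsGenericPoint (π.base ζ') D := hd' ▸ hζ'.image π.continuous
  have h2 : IsGenericPoint (π.base ζ'') D := hd'' ▸ hζ''.image π.continuous
  have hπ1 : π.base ζ' = η := h1.eq hη
  have hπ2 : π.base ζ'' = η := h2.eq hη
  have hζ : ζ' = ζ'' :=
    hfibη ⟨componentsIn.subset hZ' hζ'.mem, hπ1⟩ ⟨componentsIn.subset hZ'' hζ''.mem, hπ2⟩
  rw [← hζ'.def, ← hζ''.def, hζ]

/-! ## §3. Clause 1 of (K-ctr) at a curve-centre step -/

/-- A member of `componentsThrough N ν s` over the curve centre `D`, other than `{x_{n+1}}`, dominates `D`.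
[cite: CossartJannsenSaito2020, Thm. 3.14, Rem. 6.29 (1)] -/
theorem closure_image_eq_centre_of_mem_componentsThrough {X : Scheme.{u}} (s : MarkedStage.{u}) (π : s.W ⟶ X)
    {D : Set X} (hDc : IsClosed D) {x : X} (hπx : π.base s.pt = x)
    (hcurve : ∀ A : Set X, IsIrreducible A → IsClosed A → x ∈ A → A ⊆ D → A = {x} ∨ A = D)
    (hfibx : (Scheme.hsStratum s.W N ν ∩ π.base ⁻¹' {x}).Subsingleton)
    {Z' : Set s.W} (hZ' : Z' ∈ componentsThrough N ν s) (hZ'D : π.base '' Z' ⊆ D) (hne : Z' ≠ {s.pt}) :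
    closure (π.base '' Z') = D :=
  closure_image_eq_of_curveAt π hDc hcurve (componentsIn.isIrreducible hZ'.1) hZ'.2 hπx hZ'D
    (not_subset_fibre_of_fibre_subsingleton π (componentsIn.subset hZ'.1) hfibx hZ'.2 hne)

/-- **(K-ctr), CLAUSE 1, CURVE-CENTRE CASE**: at a step blowing up a curve `D` regular at the chain point `x_n = π(x_{n+1})`, two members
of `componentsThrough N ν s` (`s = (X_{n+1}, x_{n+1})`) mapping into `D` coincide — given the two fibre facts of CJS Thm. 3.14 (relative
form, BY NAME): at most one point of `X_{n+1}(ν)` over the closed point `x_n`, and at most one over the generic point `η` of `D`.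
[cite: CossartJannsenSaito2020, Thm. 3.14, Thm. 3.6, Rem. 6.29 (1)] -/
theorem strataCentreMembersClean_curveCase_unique {X : Scheme.{u}} (s : MarkedStage.{u}) (π : s.W ⟶ X)
    {D : Set X} (hDc : IsClosed D) {x : X} (hπx : π.base s.pt = x)
    (hcurve : ∀ A : Set X, IsIrreducible A → IsClosed A → x ∈ A → A ⊆ D → A = {x} ∨ A = D)
    {η : X} (hη : IsGenericPoint η D) (hWc : IsClosed (Scheme.hsStratum s.W N ν))
    (hfibx : (Scheme.hsStratum s.W N ν ∩ π.base ⁻¹' {x}).Subsingleton)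
    (hfibη : (Scheme.hsStratum s.W N ν ∩ π.base ⁻¹' {η}).Subsingleton)
    {Z' Z'' : Set s.W} (hZ' : Z' ∈ componentsThrough N ν s) (hZ'' : Z'' ∈ componentsThrough N ν s)
    (hZ'D : π.base '' Z' ⊆ D) (hZ''D : π.base '' Z'' ⊆ D) : Z' = Z'' := by
  -- components of the stratum are maximal irreducible subsets
  have hmax : ∀ {A B : Set s.W}, A ∈ componentsThrough N ν s → B ∈ componentsThrough N ν s → A ⊆ B → A = B :=
    fun hA hB hAB => Set.Subset.antisymm hAB
      ((mem_componentsIn_iff.1 hA.1).2.2 _ (componentsIn.subset hB.1) (componentsIn.isIrreducible hB.1) hAB)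
  by_cases h1 : Z' = {s.pt}
  · exact hmax hZ' hZ'' (by rw [h1]; exact Set.singleton_subset_iff.2 hZ''.2)
  by_cases h2 : Z'' = {s.pt}
  · exact (hmax hZ'' hZ' (by rw [h2]; exact Set.singleton_subset_iff.2 hZ'.2)).symm
  exact dominant_unique_of_fibre_subsingleton π hη hWc hfibη hZ'.1 hZ''.1
    (closure_image_eq_centre_of_mem_componentsThrough s π hDc hπx hcurve hfibx hZ' hZ'D h1)
    (closure_image_eq_centre_of_mem_componentsThrough s π hDc hπx hcurve hfibx hZ'' hZ''D h2)

end Summit.ResolutionOfSingularities.ResolutionOfSingularities.Theorems.SigmaMaxModificationsCorridor3.Moving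

end
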